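import Summits.ABC.IUTFork.Cor312NaiveProvPinnedWitness
import Summits.ABC.IUTFork.Cor312PilotKummerCompat
import HarnessLib

/-!
# [IUTchIII] Cor. 3.12 — REPAIR PROTOCOL over the INDEX-GENERIC pinned family: (T-b) and «insufficient» on a SECOND model,
# for an ARBITRARY candidate `H` (every index skeleton, every bad place, every prime, every `c > 0`; a two-point fibre packaged)

Proof-only support piece (D-0012; 0 definitions, 0 `Prop` facts) of the abc-iut cell for the IUT REPAIR branch (rung
LADDER-ABC:A2.RP; `HOME/plan/repair/REPAIR-SPEC.md` §2–§3), by the on-call kernel hand abc-iut-w5-d147 (gen 3). TAKES NO SIDE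
on [IUTchIII] Cor. 3.12 or on any author; candidates are hypotheses; models are toys of the typed interface.

WHY. REPAIR-SPEC §3 grades a candidate `H` by (T-b) «H fails at the pinned countermodel» and closes a row only after TWO
readers / models (single-point rule; abc-iut-w5-d161's degeneracy census: the countermodel of record `PinnedWitness.pinnedSetting`
lives over the ONE-place index `toyIndex`, `l⋆ = 2`). The protocol files of record P1 (abc-iut-w4-d021
`Cor312PinnedCandidateProtocol`), P2 (abc-iut-rp-cx `Repair/EvalToolkit`), P3/P6 (abc-iut-w5-d068) all evaluate at `toyIndex`.
A SECOND test bed along the INDEX axis is already in the tree: abc-iut-w4-d026's index-generic pinned family (p422593 … p427703)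
`NaiveProv.pinnedSetting p v₁ hv₁ c` over `NaiveProv.full1 p (T.over v₁) c` for EVERY `T : Thm311.ThetaIndex` (arbitrarily many
bad places, fibres of any size, general `l⋆`; regions = `p`-adic cylinders along one packet coordinate; indeterminacies by signs),
with operators `NaiveProv.orbitRegion p` / `NaiveProv.qDatum p v₁ hv₁ c`, typed Thm. 3.11 (`full1_statement`), the three pins
(`pinnedSetting_pinnedRegions3`), `BridgeHyps`, `AbsLogQPos`, and `¬ PilotKummerIndRelated` / `¬ GapH3` / `¬ Licence` / `¬ Statement`
(PR-3 abc-iut-w4-d006 2026-08-26T06:16:47Z «(B4) NEW T-b DATA POINT»). THIS FILE packages that family as protocol theorems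
for an ARBITRARY candidate `H` (a bound variable of the PR-1 arity `∀ {T} (S : LatticeSituation T) (P : Cor312.Setting
S.toSituation) ρ qK, Prop`), so that a repair row obtains its second-model (T-b) cell with ONE `exact`:

* §1 (T-b, ∀-form) `candidate_fails_on_naiveProv_of_residual` — if `H` supplies the residual S under Thm. 3.11 (ii)(b) `KummerB`
  and the three pins, then `H` is FALSE at every member `(T, p, v₁, c)` of the family; `…_of_hull` — the same for a HULL-level
  supplier (`H ⊢ Cor312Vol.PilotKummerCompatHull`, hence the (xi-f) `Licence` under the q-pin), `c > 0`; `…_of_statement` —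
  the same for a Statement-level supplier (under typed Thm. 3.11, `BridgeHyps`, `AbsLogQPos`, pins), `c > 0`;
* §2 («insufficient») `insufficient_of_holds_on_naiveProv{,_hull,_statement}` — if `H` HOLDS at one member (`c > 0`), the
  derivation schemas `∀ …, interface → pins → H → target` are FALSE at levels R / H / S;
* §3 (the literal multi-place data point) `sufficient_candidate_refuted_on_two_point_fibre` — for every residual-level supplier
  `H` there is an index skeleton WITH A TWO-POINT FIBRE (built inside the proof: two valuations over one rational place, both
  bad, `l⋆ = 2`), a full situation satisfying the typed Thm. 3.11 and a three-pinned setting with every bridge hypothesis and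
  `|log(q)| > 0` at which `H`, S and the Statement all FAIL; `two_point_fibre_pinned_countermodel` is the `H`-free package.

HONEST SCOPE: the NaiveProv family removes the ONE-PLACE / `l⋆ = 2` degeneracy only; indeterminacies still act by signs and the
columns coincide (abc-iut-w4-d101's unit / line-varying model, in progress, addresses those). Nothing here says which reading of
Step (xi) is right. [claim: Mochizuki2012, status: disputed] [cite: ScholzeStix2018, §2.2 pp. 9–10] Standard axioms; typed ≠ proved.
-/

noncomputable section

open Set

namespace Summit.ABC.IUTFork.Cor312Vol.NaiveProv

open Thm311 Cor312 Cor312Vol Literature.IUT.LogThetaLattice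

section Protocol

variable (H : ∀ {T : ThetaIndex} (S : LatticeSituation T) (P : Cor312.Setting S.toSituation),
    ((∀ v : T.V, v ∈ T.Vbad → Set (S.L.StarPacket v)) → ∀ (j : T.Label) (vQ : T.VQ), Set (S.L.Packet j vQ)) →
    (∀ v : T.V, v ∈ T.Vbad → Set (S.L.StarPacket v)) → Prop)

/-! ## 1. (T-b) on the whole index-generic family -/

/-- **(T-b), ∀-form, level R**: a candidate that SUPPLIES the residual `PilotKummerIndRelated` under Thm. 3.11 (ii) (b) for the column
and the three pins is FALSE at EVERY member of abc-iut-w4-d026's index-generic pinned family — every index skeleton `T`, every prime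
`p`, every bad place `v₁`, every `c` (there `KummerB` and the pins hold and the residual fails, `NaiveProv.pinnedSetting_not_pilotKummerIndRelated`).
[claim: Mochizuki2012, status: disputed] -/
theorem candidate_fails_on_naiveProv_of_residual
    (hS : ∀ {T : ThetaIndex} (S : LatticeSituation T) (P : Cor312.Setting S.toSituation)
      (ρ : (∀ v : T.V, v ∈ T.Vbad → Set (S.L.StarPacket v)) → ∀ (j : T.Label) (vQ : T.VQ), Set (S.L.Packet j vQ))
      (qK : ∀ v : T.V, v ∈ T.Vbad → Set (S.L.StarPacket v)),
      (S.col P.n).KummerB (S.D P.n) → PinnedRegions3 S P ρ qK → H S P ρ qK → PilotKummerIndRelated S P ρ qK)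
    {T : ThetaIndex} (p : ℕ) [Fact p.Prime] (v₁ : T.V) (hv₁ : v₁ ∈ T.Vbad) (c : ℝ) :
    ¬ H (full1 p (T.over v₁) c).toLatticeSituation (pinnedSetting p v₁ hv₁ c) (orbitRegion p) (qDatum p v₁ hv₁ c) :=
  fun h => pinnedSetting_not_pilotKummerIndRelated p v₁ hv₁ c
    (hS _ _ _ _ (GluedMonoids.kummerB_of_statement (full1 p (T.over v₁) c) (full1_statement p (T.over v₁) c) _)
      (pinnedSetting_pinnedRegions3 p v₁ hv₁ c) h)

/-- **(T-b), ∀-form, HULL level** (`c > 0`): a candidate that supplies abc-iut-w5-d068's hull-level clause `PilotKummerCompatHull`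
under `KummerB` and the three pins is FALSE at every member of the family — there the q-pin holds, so the hull clause would give the
(xi-f) `Licence` (`licence_of_pilotKummerCompatHull`), which fails (`NaiveProv.pinnedSetting_not_licence`: no inflation in the cylinder
frame). [claim: Mochizuki2012, status: disputed] -/
theorem candidate_fails_on_naiveProv_of_hull
    (hH : ∀ {T : ThetaIndex} (S : LatticeSituation T) (P : Cor312.Setting S.toSituation)
      (ρ : (∀ v : T.V, v ∈ T.Vbad → Set (S.L.StarPacket v)) → ∀ (j : T.Label) (vQ : T.VQ), Set (S.L.Packet j vQ))
      (qK : ∀ v : T.V, v ∈ T.Vbad → Set (S.L.StarPacket v)),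
      (S.col P.n).KummerB (S.D P.n) → PinnedRegions3 S P ρ qK → H S P ρ qK → PilotKummerCompatHull S P ρ qK)
    {T : ThetaIndex} (p : ℕ) [Fact p.Prime] (v₁ : T.V) (hv₁ : v₁ ∈ T.Vbad) (c : ℝ) (hc : 0 < c) :
    ¬ H (full1 p (T.over v₁) c).toLatticeSituation (pinnedSetting p v₁ hv₁ c) (orbitRegion p) (qDatum p v₁ hv₁ c) :=
  fun h => pinnedSetting_not_licence p v₁ hv₁ c hc
    (licence_of_pilotKummerCompatHull _ _ _ _ (pinnedSetting_pinnedRegions3 p v₁ hv₁ c).1.2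
      (hH _ _ _ _ (GluedMonoids.kummerB_of_statement (full1 p (T.over v₁) c) (full1_statement p (T.over v₁) c) _)
        (pinnedSetting_pinnedRegions3 p v₁ hv₁ c) h))

/-- **(T-b), ∀-form, STATEMENT level** (`c > 0`): a candidate from which the printed Statement follows under the typed Thm. 3.11,
the bridge hypotheses, `|log(q)| > 0` and the three pins is FALSE at every member of the family (all antecedents hold there and the
Statement fails, `NaiveProv.pinnedSetting_not_statement`). [claim: Mochizuki2012, status: disputed] -/
theorem candidate_fails_on_naiveProv_of_statement
    (hSt : ∀ {T : ThetaIndex} (F : FullSituation T) (P : Cor312.Setting F.toLatticeSituation.toSituation)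
      (ρ : (∀ v : T.V, v ∈ T.Vbad → Set (F.L.StarPacket v)) → ∀ (j : T.Label) (vQ : T.VQ), Set (F.L.Packet j vQ))
      (qK : ∀ v : T.V, v ∈ T.Vbad → Set (F.L.StarPacket v)),
      F.Statement → BridgeHyps P → P.AbsLogQPos → PinnedRegions3 F.toLatticeSituation P ρ qK →
        H F.toLatticeSituation P ρ qK → P.Statement)
    {T : ThetaIndex} (p : ℕ) [Fact p.Prime] (v₁ : T.V) (hv₁ : v₁ ∈ T.Vbad) (c : ℝ) (hc : 0 < c) :
    ¬ H (full1 p (T.over v₁) c).toLatticeSituation (pinnedSetting p v₁ hv₁ c) (orbitRegion p) (qDatum p v₁ hv₁ c) :=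
  fun h => pinnedSetting_not_statement p v₁ hv₁ c hc
    (hSt (full1 p (T.over v₁) c) _ _ _ (full1_statement p (T.over v₁) c) (pinnedSetting_bridgeHyps p v₁ hv₁ c hc.le)
      (pinnedSetting_absLogQPos p v₁ hv₁ c hc) (pinnedSetting_pinnedRegions3 p v₁ hv₁ c) h)

/-! ## 2. «INSUFFICIENT»: a candidate TRUE at one member cannot supply the target -/

/-- **INSUFFICIENT at level R**: if `H` HOLDS at one member of the index-generic pinned family (`c > 0`), the derivation schema
«typed Thm. 3.11 → BridgeHyps → AbsLogQPos → pins → H → S» is FALSE (all antecedents hold there, S fails). [claim: Mochizuki2012, status: disputed] -/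
theorem insufficient_of_holds_on_naiveProv {T : ThetaIndex} (p : ℕ) [Fact p.Prime] (v₁ : T.V) (hv₁ : v₁ ∈ T.Vbad)
    (c : ℝ) (hc : 0 < c)
    (h : H (full1 p (T.over v₁) c).toLatticeSituation (pinnedSetting p v₁ hv₁ c) (orbitRegion p) (qDatum p v₁ hv₁ c)) :
    ¬ ∀ {T : ThetaIndex} (F : FullSituation T) (P : Cor312.Setting F.toLatticeSituation.toSituation)
        (ρ : (∀ v : T.V, v ∈ T.Vbad → Set (F.L.StarPacket v)) → ∀ (j : T.Label) (vQ : T.VQ), Set (F.L.Packet j vQ))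
        (qK : ∀ v : T.V, v ∈ T.Vbad → Set (F.L.StarPacket v)),
        F.Statement → BridgeHyps P → P.AbsLogQPos → PinnedRegions3 F.toLatticeSituation P ρ qK →
          H F.toLatticeSituation P ρ qK → PilotKummerIndRelated F.toLatticeSituation P ρ qK :=
  fun hall => pinnedSetting_not_pilotKummerIndRelated p v₁ hv₁ c
    (hall (full1 p (T.over v₁) c) _ _ _ (full1_statement p (T.over v₁) c) (pinnedSetting_bridgeHyps p v₁ hv₁ c hc.le)
      (pinnedSetting_absLogQPos p v₁ hv₁ c hc) (pinnedSetting_pinnedRegions3 p v₁ hv₁ c) h)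

/-- **INSUFFICIENT at the HULL level** (target `GapH3` = three pins ⟹ the (xi-f) `Licence`). [claim: Mochizuki2012, status: disputed] -/
theorem insufficient_of_holds_on_naiveProv_hull {T : ThetaIndex} (p : ℕ) [Fact p.Prime] (v₁ : T.V) (hv₁ : v₁ ∈ T.Vbad)
    (c : ℝ) (hc : 0 < c)
    (h : H (full1 p (T.over v₁) c).toLatticeSituation (pinnedSetting p v₁ hv₁ c) (orbitRegion p) (qDatum p v₁ hv₁ c)) :
    ¬ ∀ {T : ThetaIndex} (F : FullSituation T) (P : Cor312.Setting F.toLatticeSituation.toSituation)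
        (ρ : (∀ v : T.V, v ∈ T.Vbad → Set (F.L.StarPacket v)) → ∀ (j : T.Label) (vQ : T.VQ), Set (F.L.Packet j vQ))
        (qK : ∀ v : T.V, v ∈ T.Vbad → Set (F.L.StarPacket v)),
        F.Statement → BridgeHyps P → P.AbsLogQPos → PinnedRegions3 F.toLatticeSituation P ρ qK →
          H F.toLatticeSituation P ρ qK → GapH3 F.toLatticeSituation P ρ qK :=
  fun hall => pinnedSetting_not_gapH3 p v₁ hv₁ c hc
    (hall (full1 p (T.over v₁) c) _ _ _ (full1_statement p (T.over v₁) c) (pinnedSetting_bridgeHyps p v₁ hv₁ c hc.le)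
      (pinnedSetting_absLogQPos p v₁ hv₁ c hc) (pinnedSetting_pinnedRegions3 p v₁ hv₁ c) h)

/-- **INSUFFICIENT at the STATEMENT level.** [claim: Mochizuki2012, status: disputed] -/
theorem insufficient_of_holds_on_naiveProv_statement {T : ThetaIndex} (p : ℕ) [Fact p.Prime] (v₁ : T.V) (hv₁ : v₁ ∈ T.Vbad)
    (c : ℝ) (hc : 0 < c)
    (h : H (full1 p (T.over v₁) c).toLatticeSituation (pinnedSetting p v₁ hv₁ c) (orbitRegion p) (qDatum p v₁ hv₁ c)) :
    ¬ ∀ {T : ThetaIndex} (F : FullSituation T) (P : Cor312.Setting F.toLatticeSituation.toSituation)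
        (ρ : (∀ v : T.V, v ∈ T.Vbad → Set (F.L.StarPacket v)) → ∀ (j : T.Label) (vQ : T.VQ), Set (F.L.Packet j vQ))
        (qK : ∀ v : T.V, v ∈ T.Vbad → Set (F.L.StarPacket v)),
        F.Statement → BridgeHyps P → P.AbsLogQPos → PinnedRegions3 F.toLatticeSituation P ρ qK →
          H F.toLatticeSituation P ρ qK → P.Statement :=
  fun hall => pinnedSetting_not_statement p v₁ hv₁ c hc
    (hall (full1 p (T.over v₁) c) _ _ _ (full1_statement p (T.over v₁) c) (pinnedSetting_bridgeHyps p v₁ hv₁ c hc.le)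
      (pinnedSetting_absLogQPos p v₁ hv₁ c hc) (pinnedSetting_pinnedRegions3 p v₁ hv₁ c) h)

/-! ## 3. The literal MULTI-PLACE data point: an index skeleton with a two-point fibre -/

/-- **An `H`-free package: a three-pinned countermodel over an index skeleton WITH A TWO-POINT FIBRE.** There is an index skeleton
(`l⋆ = 2`; TWO valuations over ONE rational place, both bad — built inside this proof, no new definition) carrying a full situation
that satisfies the typed [IUTchIII] Thm. 3.11 (i)∧(ii)∧(iii) and a setting with every bridge hypothesis, `|log(q)| > 0` and the three
printed pins, at which the residual S, the hull-level `GapH3`, the (xi-f) `Licence` and the typed Statement all FAIL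
(abc-iut-w4-d026's `exists_pinnedWitness` at that skeleton, `c = 1`). [claim: Mochizuki2012, status: disputed] -/
theorem two_point_fibre_pinned_countermodel :
    ∃ (T : ThetaIndex) (_ : ∃ (vQ : T.VQ) (v v' : T.Fibre vQ), v ≠ v') (F : FullSituation T)
      (P : Cor312.Setting F.toLatticeSituation.toSituation)
      (ρ : (∀ v : T.V, v ∈ T.Vbad → Set (F.L.StarPacket v)) → ∀ (j : T.Label) (vQ : T.VQ), Set (F.L.Packet j vQ))
      (qK : ∀ v : T.V, v ∈ T.Vbad → Set (F.L.StarPacket v)),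
      F.Statement ∧ BridgeHyps P ∧ P.AbsLogQPos ∧ PinnedRegions3 F.toLatticeSituation P ρ qK ∧
        ¬ PilotKummerIndRelated F.toLatticeSituation P ρ qK ∧ ¬ GapH3 F.toLatticeSituation P ρ qK ∧
        ¬ Thm311ToCor312.Licence P ∧ ¬ P.Statement := by
  let T : ThetaIndex :=
    { lstar := 2
      two_le_lstar := le_rfl
      V := Fin 2
      VQ := Unit
      over := fun _ => ()
      IsNon := fun _ => True
      fibre_finite := fun _ => Set.toFinite _
      fibre_nonempty := fun _ => ⟨0, rfl⟩
      Vbad := Set.univ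
      Vbad_nonempty := ⟨0, trivial⟩
      Vbad_finite := Set.toFinite _
      Vbad_non := fun _ _ => trivial }
  obtain ⟨F, P, ρ, qK, hF, -, -, -, -, hB, hpos, -, -, hpin, -, -, hH3, hS, -, hL, hSt, -⟩ :=
    exists_pinnedWitness T 1 one_pos
  refine ⟨T, ⟨(), ⟨(0 : Fin 2), rfl⟩, ⟨(1 : Fin 2), rfl⟩, fun h => ?_⟩, F, P, ρ, qK, hF, hB, hpos, hpin, hS, hH3, hL, hSt⟩
  have h01 : ((0 : Fin 2) : T.V) = (1 : Fin 2) := congrArg Subtype.val h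
  exact absurd h01 (by decide)

/-- **(T-b) on the literal multi-place model, for an ARBITRARY residual-level supplier `H`**: some index skeleton with a two-point
fibre carries a typed-Thm-3.11 / three-pinned / bridge-complete / `|log(q)| > 0` setting at which `H`, S and the Statement all fail.
One `exact` per repair row for the second-model T-b cell (index axis). [claim: Mochizuki2012, status: disputed] -/
theorem sufficient_candidate_refuted_on_two_point_fibre
    (hS : ∀ {T : ThetaIndex} (S : LatticeSituation T) (P : Cor312.Setting S.toSituation)
      (ρ : (∀ v : T.V, v ∈ T.Vbad → Set (S.L.StarPacket v)) → ∀ (j : T.Label) (vQ : T.VQ), Set (S.L.Packet j vQ))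
      (qK : ∀ v : T.V, v ∈ T.Vbad → Set (S.L.StarPacket v)),
      (S.col P.n).KummerB (S.D P.n) → PinnedRegions3 S P ρ qK → H S P ρ qK → PilotKummerIndRelated S P ρ qK) :
    ∃ (T : ThetaIndex) (_ : ∃ (vQ : T.VQ) (v v' : T.Fibre vQ), v ≠ v') (F : FullSituation T)
      (P : Cor312.Setting F.toLatticeSituation.toSituation)
      (ρ : (∀ v : T.V, v ∈ T.Vbad → Set (F.L.StarPacket v)) → ∀ (j : T.Label) (vQ : T.VQ), Set (F.L.Packet j vQ))
      (qK : ∀ v : T.V, v ∈ T.Vbad → Set (F.L.StarPacket v)),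
      F.Statement ∧ BridgeHyps P ∧ P.AbsLogQPos ∧ PinnedRegions3 F.toLatticeSituation P ρ qK ∧
        ¬ H F.toLatticeSituation P ρ qK ∧ ¬ PilotKummerIndRelated F.toLatticeSituation P ρ qK ∧ ¬ P.Statement := by
  obtain ⟨T, hT, F, P, ρ, qK, hF, hB, hpos, hpin, hS', -, -, hSt⟩ := two_point_fibre_pinned_countermodel
  exact ⟨T, hT, F, P, ρ, qK, hF, hB, hpos, hpin,
    fun h => hS' (hS _ _ _ _ (GluedMonoids.kummerB_of_statement F hF _) hpin h), hS', hSt⟩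

/-- **(T-b) on the literal multi-place model, for an ARBITRARY HULL-level supplier `H`** (the branch's PRIMARY target level): some
index skeleton with a two-point fibre carries a typed-Thm-3.11 / three-pinned / bridge-complete / `|log(q)| > 0` setting at which
`H`, the hull-level `GapH3`, the (xi-f) `Licence` and the Statement all fail. [claim: Mochizuki2012, status: disputed] -/
theorem hull_candidate_refuted_on_two_point_fibre
    (hH : ∀ {T : ThetaIndex} (S : LatticeSituation T) (P : Cor312.Setting S.toSituation)
      (ρ : (∀ v : T.V, v ∈ T.Vbad → Set (S.L.StarPacket v)) → ∀ (j : T.Label) (vQ : T.VQ), Set (S.L.Packet j vQ))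
      (qK : ∀ v : T.V, v ∈ T.Vbad → Set (S.L.StarPacket v)),
      (S.col P.n).KummerB (S.D P.n) → PinnedRegions3 S P ρ qK → H S P ρ qK → PilotKummerCompatHull S P ρ qK) :
    ∃ (T : ThetaIndex) (_ : ∃ (vQ : T.VQ) (v v' : T.Fibre vQ), v ≠ v') (F : FullSituation T)
      (P : Cor312.Setting F.toLatticeSituation.toSituation)
      (ρ : (∀ v : T.V, v ∈ T.Vbad → Set (F.L.StarPacket v)) → ∀ (j : T.Label) (vQ : T.VQ), Set (F.L.Packet j vQ))
      (qK : ∀ v : T.V, v ∈ T.Vbad → Set (F.L.StarPacket v)),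
      F.Statement ∧ BridgeHyps P ∧ P.AbsLogQPos ∧ PinnedRegions3 F.toLatticeSituation P ρ qK ∧
        ¬ H F.toLatticeSituation P ρ qK ∧ ¬ GapH3 F.toLatticeSituation P ρ qK ∧ ¬ Thm311ToCor312.Licence P ∧
        ¬ P.Statement := by
  obtain ⟨T, hT, F, P, ρ, qK, hF, hB, hpos, hpin, -, hH3, hL, hSt⟩ := two_point_fibre_pinned_countermodel
  exact ⟨T, hT, F, P, ρ, qK, hF, hB, hpos, hpin,
    fun h => hL (licence_of_pilotKummerCompatHull _ _ _ _ hpin.1.2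
      (hH _ _ _ _ (GluedMonoids.kummerB_of_statement F hF _) hpin h)), hH3, hL, hSt⟩

end Protocol

end Summit.ABC.IUTFork.Cor312Vol.NaiveProv

end
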